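import Literature.NumberTheory.Sieve.SmoothSaddleKernelWindow
import Literature.NumberTheory.Sieve.SmoothSaddleKernelWindowSymm
import HarnessLib

/-!
# The saddle-point method on `Re s = α(x,y)`: parametric window `W/√φ` at SECOND order

Topic `Literature/NumberTheory/Sieve`; a PROVED tool file sharpening `SmoothSaddleKernelWindow`
([HildebrandTenenbaum1986, §4 (Lemmas 10–11)]). With `α = α(x,y)`, `φ = φ₂(α,y)`, `Φ₃ = −φ₃(α,y)`,
`Φ₄ = φ₄(α,y)`, `f_A(t) = exp(e(t)) A(t)` for an abstract kernel `A` with `‖A t‖ ≤ B₀` (`|t| ≤ 3`),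
`‖A t − A 0‖ ≤ B₁|t|`, `‖A t + A(−t) − 2A 0‖ ≤ B₂t²` (`|t| ≤ 1`), `‖A t‖ ≤ B_a`, `‖A t‖ ≤ B₃/|t|³`
(`|t| > T`), window `τ = W/√φ` (`W > 0` a parameter):

* `norm_kernelIntegral_sub_main_le_window₂` — the symmetrised second-order window
  `SaddleKernel.norm_windowIntegral_sub_le₂` plus the tails `SaddleKernel.norm_tailIntegral_le_window`;
* `norm_kernelIntegral_sub_main_le_window₂'` — the same with `Φ₃ ≤ 5 log y · φ`, `Φ₄ ≤ 37 log² y · φ`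
  (`saddlePhi₃_le_mul_saddlePhi₂`, `saddlePhi₄_le_mul_saddlePhi₂`) and numerical constants substituted:
  `‖∫ f_A − A(0)√(2π/φ)‖ ≤ B₀e^{−W²/4}√(4π/φ) + √(4π/φ)(B₂ + B₁(15ℓ + 666ℓ²τ) + 458B₀ℓ² + 35·10⁵B₀ℓ⁴/φ)/φ`
  `+ B₀e^{−W²/140}√(125π³/φ) + 10πε₁B₀/α + 2πε₂B_aT + 2πB₃/T²` (`ℓ = log y`): compared with
  `norm_kernelIntegral_sub_main_le_window` the window term `(1475B₀ℓ + 4B₁)/φ` (relative size `ℓ/√φ`)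
  is replaced by terms of relative size `O((B₂/B₀ + ℓB₁/B₀ + ℓ²)/φ) = O(1/u)`;
* `window_range₂` — the window hypothesis `Φ₃τ³/6 + Φ₄τ⁴ ≤ 1` follows from `169 W⁶/c ≤ r⁴`
  (the hypothesis of `window_range`).

## References

* A. Hildebrand, G. Tenenbaum, Trans. AMS 296 (1986), §4 (Lemmas 10–11) [HildebrandTenenbaum1986].
* A. J. Harper, Compositio Math. 152 (2016), §5 [Harper2016].
-/

noncomputable section

open Real Complex MeasureTheory Set Filter
open scoped Topology

namespace Literature.NumberTheory.Sieve

namespace SaddleKernel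

/-! ### Assembly with the tails -/

set_option maxHeartbeats 800000 in
/-- **The saddle point with an abstract kernel, parametric window `W/√φ`, second order.** Under the
hypotheses of `norm_tailIntegral_le_window` and of `norm_windowIntegral_sub_le₂` at `τ = W/√φ`
(`Φ₃τ³/6 + Φ₄τ⁴ ≤ 1`, `‖A t − A 0‖ ≤ B₁|t|`, `‖A t + A(−t) − 2A 0‖ ≤ B₂t²` for `|t| ≤ 1`):
`‖∫ f_A − A(0)√(2π/φ)‖ ≤ ‖A 0‖ e^{−W²/4}√(4π/φ) + √(4π/φ) Σ_m c_{2m}(4m/(eφ))^m`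
`+ B₀e^{−W²/140}√(125π³/φ) + 10πε₁B₀/α + 2πε₂B_aT + 2πB₃/T²`, with the `c_{2m}` of
`norm_windowIntegral_sub_le₂`. [cite: HildebrandTenenbaum1986, §4 (Lemmas 10–11)] -/
theorem norm_kernelIntegral_sub_main_le_window₂ {x T ε₁ ε₂ B₀ B₁ B₂ Ba B₃ W : ℝ} {y : ℕ} {A : ℝ → ℂ}
    (hx : 1 < x) (hy : 2 ≤ y) (hα : 3 / 5 ≤ saddlePoint x y) (hα1 : saddlePoint x y ≤ 1)
    (hφ0 : 0 < saddlePhi₂ (saddlePoint x y) y) (hW : 0 < W)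
    (hτ : W / Real.sqrt (saddlePhi₂ (saddlePoint x y) y) ≤ Real.pi / Real.log y)
    (hy1 : Real.pi / Real.log y ≤ 1)
    (hη₂ : saddlePhi₃ (saddlePoint x y) y / 6 * (W / Real.sqrt (saddlePhi₂ (saddlePoint x y) y)) ^ 3 +
      saddlePhi₄ (saddlePoint x y) y * (W / Real.sqrt (saddlePhi₂ (saddlePoint x y) y)) ^ 4 ≤ 1)
    (hT : 3 ≤ T) (hε₁ : 0 ≤ ε₁) (hε₂ : 0 ≤ ε₂)
    (hdec1 : ∀ t : ℝ, Real.pi / Real.log y ≤ |t| → |t| ≤ 3 →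
      ‖smoothZetaC ((saddlePoint x y : ℂ) + t * I) y‖ / smoothZeta (saddlePoint x y) y ≤ ε₁)
    (hdec2 : ∀ t : ℝ, 3 ≤ |t| → |t| ≤ T →
      ‖smoothZetaC ((saddlePoint x y : ℂ) + t * I) y‖ / smoothZeta (saddlePoint x y) y ≤ ε₂)
    (hA : Continuous A) (hAi : Integrable A) (hB₀ : 0 ≤ B₀) (hB₁ : 0 ≤ B₁) (hB₂ : 0 ≤ B₂) (hBa : 0 ≤ Ba)
    (hB₃ : 0 ≤ B₃)
    (hB0 : ∀ t : ℝ, |t| ≤ 3 → ‖A t‖ ≤ B₀) (hB1 : ∀ t : ℝ, |t| ≤ 1 → ‖A t - A 0‖ ≤ B₁ * |t|)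
    (hB2 : ∀ t : ℝ, |t| ≤ 1 → ‖A t + A (-t) - 2 * A 0‖ ≤ B₂ * t ^ 2)
    (hBall : ∀ t : ℝ, ‖A t‖ ≤ Ba) (hB3 : ∀ t : ℝ, T < |t| → ‖A t‖ ≤ B₃ / |t| ^ 3) :
    ‖(∫ t, kernelIntegrand x (saddlePoint x y) y A t) -
        A 0 * (Real.sqrt (2 * Real.pi / saddlePhi₂ (saddlePoint x y) y) : ℂ)‖ ≤
      ‖A 0‖ * (Real.exp (-(W ^ 2 / 4)) * Real.sqrt (4 * Real.pi / saddlePhi₂ (saddlePoint x y) y)) +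
        Real.sqrt (4 * Real.pi / saddlePhi₂ (saddlePoint x y) y) *
          (B₂ / 2 * (4 * 1 / (Real.exp 1 * saddlePhi₂ (saddlePoint x y) y)) ^ 1 +
            (2 * B₁ * (saddlePhi₃ (saddlePoint x y) y / 6 +
                saddlePhi₄ (saddlePoint x y) y * (W / Real.sqrt (saddlePhi₂ (saddlePoint x y) y))) +
                ‖A 0‖ * saddlePhi₄ (saddlePoint x y) y) *
              (4 * 2 / (Real.exp 1 * saddlePhi₂ (saddlePoint x y) y)) ^ 2 +
            ‖A 0‖ * saddlePhi₃ (saddlePoint x y) y ^ 2 / 18 *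
              (4 * 3 / (Real.exp 1 * saddlePhi₂ (saddlePoint x y) y)) ^ 3 +
            2 * ‖A 0‖ * saddlePhi₄ (saddlePoint x y) y ^ 2 *
              (4 * 4 / (Real.exp 1 * saddlePhi₂ (saddlePoint x y) y)) ^ 4) +
        (B₀ * Real.exp (-(W ^ 2 / 140)) * Real.sqrt (125 * Real.pi ^ 3 / saddlePhi₂ (saddlePoint x y) y) +
          10 * Real.pi * ε₁ * B₀ / saddlePoint x y + 2 * Real.pi * ε₂ * Ba * T + 2 * Real.pi * B₃ / T ^ 2) := by
  set α : ℝ := saddlePoint x y with hαdef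
  have hα0 : 0 < α := by linarith
  set φ : ℝ := saddlePhi₂ α y with hφ
  set Φ : ℝ := Real.sqrt φ with hΦ
  have hΦ0 : 0 < Φ := Real.sqrt_pos.mpr hφ0
  have hΦsq : Φ ^ 2 = φ := Real.sq_sqrt hφ0.le
  set τ : ℝ := W / Φ with hτdef
  have hτ0 : 0 < τ := by positivity
  have hτ1 : τ ≤ 1 := hτ.trans hy1
  have hτsq : -(φ / 4) * τ ^ 2 = -(W ^ 2 / 4) := by
    rw [hτdef, div_pow, hΦsq]; field_simp
  have hf : Integrable (kernelIntegrand x α y A) := integrable_kernelIntegrand hα0 x y hA hAi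
  have hsplit : ∫ t, kernelIntegrand x α y A t =
      (∫ t in Icc (-τ) τ, kernelIntegrand x α y A t) + ∫ t in (Icc (-τ) τ)ᶜ, kernelIntegrand x α y A t :=
    (integral_add_compl measurableSet_Icc hf).symm
  have hwin := norm_windowIntegral_sub_le₂ hx hy hτ0.le hτ1 hη₂ hA hB₁ hB₂ hB1 hB2
  have htail := norm_tailIntegral_le_window hy hα hα1 hφ0 hW hτ hy1 hT hε₁ hε₂ hdec1 hdec2 hA hAi hB₀ hBa hB₃
    hB0 hBall hB3
  rw [hτsq] at hwin
  rw [← hφ] at hwin htail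
  rw [← hΦ] at htail
  rw [← hτdef] at htail
  rw [hsplit]
  set Wi := ∫ t in Icc (-τ) τ, kernelIntegrand x α y A t with hWi
  set Tl := ∫ t in (Icc (-τ) τ)ᶜ, kernelIntegrand x α y A t with hTl
  have halg : Wi + Tl - A 0 * (Real.sqrt (2 * Real.pi / φ) : ℂ) =
      (Wi - A 0 * (Real.sqrt (2 * Real.pi / φ) : ℂ)) + Tl := by ring
  rw [halg]
  exact (norm_add_le _ _).trans (add_le_add hwin htail)

/-! ### Substituting `Φ₃ ≤ 5 log y · φ`, `Φ₄ ≤ 37 log² y · φ` -/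

/-- Numerical constants: with `e = exp 1 ≥ 2.7`, `(B₂/2)(4/(eφ)) ≤ B₂/φ`, `(8/(eφ))² ≤ 9/φ²`,
`(12/(eφ))³ ≤ 90/φ³`, `(16/(eφ))⁴ ≤ 1250/φ⁴` (`φ > 0`). [folklore] -/
theorem exp_window_consts {φ : ℝ} (hφ : 0 < φ) :
    (4 * 1 / (Real.exp 1 * φ)) ^ 1 ≤ 2 / φ ∧ (4 * 2 / (Real.exp 1 * φ)) ^ 2 ≤ 9 / φ ^ 2 ∧
      (4 * 3 / (Real.exp 1 * φ)) ^ 3 ≤ 90 / φ ^ 3 ∧ (4 * 4 / (Real.exp 1 * φ)) ^ 4 ≤ 1250 / φ ^ 4 := by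
  have hE : (27 / 10 : ℝ) ≤ Real.exp 1 := by have := Real.exp_one_gt_d9; linarith
  have hE0 : 0 < Real.exp 1 := Real.exp_pos 1
  refine ⟨?_, ?_, ?_, ?_⟩
  · rw [pow_one, div_le_div_iff₀ (by positivity) hφ]; nlinarith
  · rw [div_pow, mul_pow, div_le_div_iff₀ (by positivity) (by positivity)]
    have : (64 : ℝ) ≤ 9 * Real.exp 1 ^ 2 := by nlinarith
    nlinarith [pow_pos hφ 2]
  · rw [div_pow, mul_pow, div_le_div_iff₀ (by positivity) (by positivity)]
    have h3 : Real.exp 1 ^ 3 ≥ (27 / 10) ^ 3 := pow_le_pow_left₀ (by norm_num) hE 3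
    have : (1728 : ℝ) ≤ 90 * Real.exp 1 ^ 3 := by nlinarith
    nlinarith [pow_pos hφ 3]
  · rw [div_pow, mul_pow, div_le_div_iff₀ (by positivity) (by positivity)]
    have h4 : Real.exp 1 ^ 4 ≥ (27 / 10) ^ 4 := pow_le_pow_left₀ (by norm_num) hE 4
    have : (65536 : ℝ) ≤ 1250 * Real.exp 1 ^ 4 := by nlinarith
    nlinarith [pow_pos hφ 4]

set_option maxHeartbeats 800000 in
/-- **The saddle point with an abstract kernel, second-order window, explicit constants.** Under the
hypotheses of `norm_kernelIntegral_sub_main_le_window₂`, with `ℓ = log y`, `τ = W/√φ`: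
`‖∫ f_A − A(0)√(2π/φ)‖ ≤ B₀ e^{−W²/4}√(4π/φ) + √(4π/φ)(B₂ + B₁(15ℓ + 666ℓ²τ) + 458B₀ℓ² + 35·10⁵B₀ℓ⁴/φ)/φ`
`+ B₀e^{−W²/140}√(125π³/φ) + 10πε₁B₀/α + 2πε₂B_aT + 2πB₃/T²`
(`Φ₃ ≤ 5ℓφ`, `Φ₄ ≤ 37ℓ²φ`: `saddlePhi₃_le_mul_saddlePhi₂`, `saddlePhi₄_le_mul_saddlePhi₂`; `‖A 0‖ ≤ B₀`).
Every window term is now `O(B₀ℓ²/φ^{3/2})`-shaped, a RELATIVE error `O(1/u)` against `A(0)√(2π/φ)`.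
[cite: HildebrandTenenbaum1986, §4 (Lemmas 10–11)] -/
theorem norm_kernelIntegral_sub_main_le_window₂' {x T ε₁ ε₂ B₀ B₁ B₂ Ba B₃ W : ℝ} {y : ℕ} {A : ℝ → ℂ}
    (hx : 1 < x) (hy : 2 ≤ y) (hα : 3 / 5 ≤ saddlePoint x y) (hα1 : saddlePoint x y ≤ 1)
    (hφ0 : 0 < saddlePhi₂ (saddlePoint x y) y) (hW : 0 < W)
    (hτ : W / Real.sqrt (saddlePhi₂ (saddlePoint x y) y) ≤ Real.pi / Real.log y)
    (hy1 : Real.pi / Real.log y ≤ 1)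
    (hη₂ : saddlePhi₃ (saddlePoint x y) y / 6 * (W / Real.sqrt (saddlePhi₂ (saddlePoint x y) y)) ^ 3 +
      saddlePhi₄ (saddlePoint x y) y * (W / Real.sqrt (saddlePhi₂ (saddlePoint x y) y)) ^ 4 ≤ 1)
    (hT : 3 ≤ T) (hε₁ : 0 ≤ ε₁) (hε₂ : 0 ≤ ε₂)
    (hdec1 : ∀ t : ℝ, Real.pi / Real.log y ≤ |t| → |t| ≤ 3 →
      ‖smoothZetaC ((saddlePoint x y : ℂ) + t * I) y‖ / smoothZeta (saddlePoint x y) y ≤ ε₁)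
    (hdec2 : ∀ t : ℝ, 3 ≤ |t| → |t| ≤ T →
      ‖smoothZetaC ((saddlePoint x y : ℂ) + t * I) y‖ / smoothZeta (saddlePoint x y) y ≤ ε₂)
    (hA : Continuous A) (hAi : Integrable A) (hB₀ : 0 ≤ B₀) (hB₁ : 0 ≤ B₁) (hB₂ : 0 ≤ B₂) (hBa : 0 ≤ Ba)
    (hB₃ : 0 ≤ B₃)
    (hB0 : ∀ t : ℝ, |t| ≤ 3 → ‖A t‖ ≤ B₀) (hB1 : ∀ t : ℝ, |t| ≤ 1 → ‖A t - A 0‖ ≤ B₁ * |t|)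
    (hB2 : ∀ t : ℝ, |t| ≤ 1 → ‖A t + A (-t) - 2 * A 0‖ ≤ B₂ * t ^ 2)
    (hBall : ∀ t : ℝ, ‖A t‖ ≤ Ba) (hB3 : ∀ t : ℝ, T < |t| → ‖A t‖ ≤ B₃ / |t| ^ 3) :
    ‖(∫ t, kernelIntegrand x (saddlePoint x y) y A t) -
        A 0 * (Real.sqrt (2 * Real.pi / saddlePhi₂ (saddlePoint x y) y) : ℂ)‖ ≤
      B₀ * (Real.exp (-(W ^ 2 / 4)) * Real.sqrt (4 * Real.pi / saddlePhi₂ (saddlePoint x y) y)) +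
        Real.sqrt (4 * Real.pi / saddlePhi₂ (saddlePoint x y) y) *
          ((B₂ + B₁ * (15 * Real.log y + 666 * Real.log y ^ 2 * (W / Real.sqrt (saddlePhi₂ (saddlePoint x y) y))) +
            458 * B₀ * Real.log y ^ 2 + 3500000 * B₀ * Real.log y ^ 4 / saddlePhi₂ (saddlePoint x y) y) /
            saddlePhi₂ (saddlePoint x y) y) +
        (B₀ * Real.exp (-(W ^ 2 / 140)) * Real.sqrt (125 * Real.pi ^ 3 / saddlePhi₂ (saddlePoint x y) y) +
          10 * Real.pi * ε₁ * B₀ / saddlePoint x y + 2 * Real.pi * ε₂ * Ba * T + 2 * Real.pi * B₃ / T ^ 2) := by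
  have hK := norm_kernelIntegral_sub_main_le_window₂ hx hy hα hα1 hφ0 hW hτ hy1 hη₂ hT hε₁ hε₂ hdec1 hdec2 hA hAi
    hB₀ hB₁ hB₂ hBa hB₃ hB0 hB1 hB2 hBall hB3
  refine hK.trans ?_
  set α : ℝ := saddlePoint x y with hαdef
  have hα0 : 0 < α := by linarith
  set φ : ℝ := saddlePhi₂ α y with hφ
  set Φ₃ : ℝ := saddlePhi₃ α y with hΦ₃
  set Φ₄ : ℝ := saddlePhi₄ α y with hΦ₄
  set ℓ : ℝ := Real.log y with hℓ
  set τ : ℝ := W / Real.sqrt φ with hτdef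
  have hτ0 : 0 ≤ τ := by positivity
  have hℓ0 : 0 ≤ ℓ := Real.log_nonneg (by exact_mod_cast le_trans one_le_two hy)
  have hΦ₃0 : 0 ≤ Φ₃ := saddlePhi₃_nonneg hα0 y
  have hΦ₄0 : 0 ≤ Φ₄ := saddlePhi₄_nonneg hα0 y
  have hΦ₃le : Φ₃ ≤ 5 * ℓ * φ := saddlePhi₃_le_mul_saddlePhi₂ hα y
  have hΦ₄le : Φ₄ ≤ 37 * ℓ ^ 2 * φ := saddlePhi₄_le_mul_saddlePhi₂ hα y
  have hA0 : ‖A 0‖ ≤ B₀ := hB0 0 (by norm_num)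
  have hs0 : 0 ≤ Real.sqrt (4 * Real.pi / φ) := Real.sqrt_nonneg _
  obtain ⟨c1, c2, c3, c4⟩ := exp_window_consts hφ0
  -- the Gaussian completion term
  have hT0 : ‖A 0‖ * (Real.exp (-(W ^ 2 / 4)) * Real.sqrt (4 * Real.pi / φ)) ≤
      B₀ * (Real.exp (-(W ^ 2 / 4)) * Real.sqrt (4 * Real.pi / φ)) :=
    mul_le_mul_of_nonneg_right hA0 (by positivity)
  -- the four window terms
  have hT2 : B₂ / 2 * (4 * 1 / (Real.exp 1 * φ)) ^ 1 ≤ B₂ / φ := by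
    calc B₂ / 2 * (4 * 1 / (Real.exp 1 * φ)) ^ 1 ≤ B₂ / 2 * (2 / φ) := mul_le_mul_of_nonneg_left c1 (by positivity)
      _ = B₂ / φ := by field_simp
  have hT4 : (2 * B₁ * (Φ₃ / 6 + Φ₄ * τ) + ‖A 0‖ * Φ₄) * (4 * 2 / (Real.exp 1 * φ)) ^ 2 ≤
      (B₁ * (15 * ℓ + 666 * ℓ ^ 2 * τ) + 333 * B₀ * ℓ ^ 2) / φ := by
    have h1 : 2 * B₁ * (Φ₃ / 6 + Φ₄ * τ) + ‖A 0‖ * Φ₄ ≤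
        2 * B₁ * (5 * ℓ * φ / 6 + 37 * ℓ ^ 2 * φ * τ) + B₀ * (37 * ℓ ^ 2 * φ) := by
      gcongr
    calc (2 * B₁ * (Φ₃ / 6 + Φ₄ * τ) + ‖A 0‖ * Φ₄) * (4 * 2 / (Real.exp 1 * φ)) ^ 2
        ≤ (2 * B₁ * (5 * ℓ * φ / 6 + 37 * ℓ ^ 2 * φ * τ) + B₀ * (37 * ℓ ^ 2 * φ)) * (9 / φ ^ 2) :=
          mul_le_mul h1 c2 (by positivity) (by positivity)
      _ = (B₁ * (15 * ℓ + 666 * ℓ ^ 2 * τ) + 333 * B₀ * ℓ ^ 2) / φ := by field_simp; ring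
  have hT6 : ‖A 0‖ * Φ₃ ^ 2 / 18 * (4 * 3 / (Real.exp 1 * φ)) ^ 3 ≤ 125 * B₀ * ℓ ^ 2 / φ := by
    have h1 : Φ₃ ^ 2 ≤ (5 * ℓ * φ) ^ 2 := pow_le_pow_left₀ hΦ₃0 hΦ₃le 2
    have h2 : ‖A 0‖ * Φ₃ ^ 2 / 18 ≤ B₀ * (5 * ℓ * φ) ^ 2 / 18 := by
      apply div_le_div_of_nonneg_right _ (by norm_num)
      exact mul_le_mul hA0 h1 (by positivity) hB₀
    calc ‖A 0‖ * Φ₃ ^ 2 / 18 * (4 * 3 / (Real.exp 1 * φ)) ^ 3 ≤ B₀ * (5 * ℓ * φ) ^ 2 / 18 * (90 / φ ^ 3) :=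
          mul_le_mul h2 c3 (by positivity) (by positivity)
      _ = 125 * B₀ * ℓ ^ 2 / φ := by field_simp; ring
  have hT8 : 2 * ‖A 0‖ * Φ₄ ^ 2 * (4 * 4 / (Real.exp 1 * φ)) ^ 4 ≤ 3500000 * B₀ * ℓ ^ 4 / φ / φ := by
    have h1 : Φ₄ ^ 2 ≤ (37 * ℓ ^ 2 * φ) ^ 2 := pow_le_pow_left₀ hΦ₄0 hΦ₄le 2
    have h2 : 2 * ‖A 0‖ * Φ₄ ^ 2 ≤ 2 * B₀ * (37 * ℓ ^ 2 * φ) ^ 2 := by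
      rw [mul_assoc, mul_assoc]
      exact mul_le_mul_of_nonneg_left (mul_le_mul hA0 h1 (by positivity) hB₀) (by norm_num)
    calc 2 * ‖A 0‖ * Φ₄ ^ 2 * (4 * 4 / (Real.exp 1 * φ)) ^ 4 ≤ 2 * B₀ * (37 * ℓ ^ 2 * φ) ^ 2 * (1250 / φ ^ 4) :=
          mul_le_mul h2 c4 (by positivity) (by positivity)
      _ = 3422500 * B₀ * ℓ ^ 4 / φ / φ := by field_simp; ring
      _ ≤ 3500000 * B₀ * ℓ ^ 4 / φ / φ := by gcongr; norm_num
  have hwin : B₂ / 2 * (4 * 1 / (Real.exp 1 * φ)) ^ 1 +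
      (2 * B₁ * (Φ₃ / 6 + Φ₄ * τ) + ‖A 0‖ * Φ₄) * (4 * 2 / (Real.exp 1 * φ)) ^ 2 +
      ‖A 0‖ * Φ₃ ^ 2 / 18 * (4 * 3 / (Real.exp 1 * φ)) ^ 3 +
      2 * ‖A 0‖ * Φ₄ ^ 2 * (4 * 4 / (Real.exp 1 * φ)) ^ 4 ≤
      (B₂ + B₁ * (15 * ℓ + 666 * ℓ ^ 2 * τ) + 458 * B₀ * ℓ ^ 2 + 3500000 * B₀ * ℓ ^ 4 / φ) / φ := by
    have hsum := add_le_add (add_le_add (add_le_add hT2 hT4) hT6) hT8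
    refine hsum.trans (le_of_eq ?_)
    field_simp
    ring
  have hmid := mul_le_mul_of_nonneg_left hwin hs0
  linarith [hmid, hT0]

/-! ### The window hypothesis from `169 W⁶/c ≤ r⁴` -/

/-- **The second-order window hypothesis in terms of `W`**: under the hypotheses of `window_range`
(`c > 0`, `W ≥ 1`, `0 < ℓ ≤ r`, `r⁵ = L`, `c(Lℓ) ≤ φ`, `169W⁶/c ≤ r⁴`) and `Φ₃ ≤ 5ℓφ`,
`Φ₄ ≤ 37ℓ²φ`: `Φ₃(W/√φ)³/6 + Φ₄(W/√φ)⁴ ≤ 1` (indeed `(13W³ℓ)² ≤ φ` gives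
`(5/6)ℓW³/√φ ≤ 5/78` and `37ℓ²W⁴/φ ≤ 37/169`). [folklore] -/
theorem window_range₂ {c L ℓ r W φ Φ₃ Φ₄ : ℝ} (hc : 0 < c) (hW : 1 ≤ W) (hℓ : 0 < ℓ) (hr : 0 < r)
    (hr5 : r ^ 5 = L) (hℓr : ℓ ≤ r) (hφlo : c * (L * ℓ) ≤ φ) (hQ : 169 * W ^ 6 / c ≤ r ^ 4)
    (hΦ₃ : Φ₃ ≤ 5 * ℓ * φ) (hΦ₄ : Φ₄ ≤ 37 * ℓ ^ 2 * φ) :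
    Φ₃ / 6 * (W / Real.sqrt φ) ^ 3 + Φ₄ * (W / Real.sqrt φ) ^ 4 ≤ 1 := by
  have h1 : 169 * W ^ 6 ≤ r ^ 4 * c := by rwa [div_le_iff₀ hc] at hQ
  have h2 : r ^ 4 * ℓ ≤ L := by
    calc r ^ 4 * ℓ ≤ r ^ 4 * r := mul_le_mul_of_nonneg_left hℓr (by positivity)
      _ = L := by rw [← hr5]; ring
  have h3 : (13 * W ^ 3 * ℓ) ^ 2 ≤ φ := by
    have h4 : 169 * W ^ 6 * ℓ ≤ c * L := by
      calc 169 * W ^ 6 * ℓ ≤ r ^ 4 * c * ℓ := mul_le_mul_of_nonneg_right h1 hℓ.le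
        _ = c * (r ^ 4 * ℓ) := by ring
        _ ≤ c * L := mul_le_mul_of_nonneg_left h2 hc.le
    have h5 := mul_le_mul_of_nonneg_right h4 hℓ.le
    calc (13 * W ^ 3 * ℓ) ^ 2 = 169 * W ^ 6 * ℓ * ℓ := by ring
      _ ≤ c * L * ℓ := h5
      _ = c * (L * ℓ) := by ring
      _ ≤ φ := hφlo
  have hW0 : 0 < W := by linarith only [hW]
  have hWℓ : 0 < 13 * W ^ 3 * ℓ := by positivity
  have hφ0 : 0 < φ := lt_of_lt_of_le (by positivity) h3
  set Φ := Real.sqrt φ with hΦ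
  have hΦ0 : 0 < Φ := Real.sqrt_pos.2 hφ0
  have hΦsq : Φ ^ 2 = φ := Real.sq_sqrt hφ0.le
  have h6 : 13 * W ^ 3 * ℓ ≤ Φ := by
    rw [hΦ, Real.le_sqrt hWℓ.le hφ0.le]; exact h3
  -- first term: `Φ₃ W³/(6Φ³) ≤ (5/6) ℓ φ W³/Φ³ = (5/6) ℓ W³/Φ ≤ 5/78`
  have hA : Φ₃ / 6 * (W / Φ) ^ 3 ≤ 5 / 78 := by
    have e1 : Φ₃ / 6 * (W / Φ) ^ 3 = Φ₃ * W ^ 3 / (6 * Φ ^ 3) := by rw [div_pow]; field_simp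
    rw [e1, div_le_div_iff₀ (by positivity) (by norm_num)]
    have h7 : Φ₃ * W ^ 3 ≤ 5 * ℓ * φ * W ^ 3 := mul_le_mul_of_nonneg_right hΦ₃ (by positivity)
    have h8 : 5 * ℓ * φ * W ^ 3 * 78 = 30 * φ * (13 * W ^ 3 * ℓ) := by ring
    have h9 : 30 * φ * (13 * W ^ 3 * ℓ) ≤ 30 * φ * Φ := mul_le_mul_of_nonneg_left h6 (by positivity)
    have h10 : 30 * φ * Φ = 5 * (6 * Φ ^ 3) := by rw [← hΦsq]; ring
    nlinarith [h7, h9]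
  -- second term: `Φ₄ W⁴/Φ⁴ = Φ₄ W⁴/φ² ≤ 37 ℓ² W⁴/φ ≤ 37/(169 W²) ≤ 37/169`
  have hB : Φ₄ * (W / Φ) ^ 4 ≤ 37 / 169 := by
    have e1 : Φ₄ * (W / Φ) ^ 4 = Φ₄ * W ^ 4 / φ ^ 2 := by
      rw [div_pow, show Φ ^ 4 = (Φ ^ 2) ^ 2 by ring, hΦsq]; field_simp
    rw [e1, div_le_div_iff₀ (by positivity) (by norm_num)]
    have h7 : Φ₄ * W ^ 4 ≤ 37 * ℓ ^ 2 * φ * W ^ 4 := mul_le_mul_of_nonneg_right hΦ₄ (by positivity)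
    have hW2 : 1 ≤ W ^ 2 := one_le_pow₀ hW
    -- `169 ℓ² W⁶ ≤ φ`, so `37 ℓ² φ W⁴ · 169 ≤ 37 φ · 169 ℓ² W⁶ / W² ≤ 37 φ²`
    have h8 : 169 * ℓ ^ 2 * W ^ 6 ≤ φ := by nlinarith [h3]
    have h9 : 37 * ℓ ^ 2 * φ * W ^ 4 * 169 ≤ 37 * φ ^ 2 := by
      have h10 : 37 * ℓ ^ 2 * φ * W ^ 4 * 169 ≤ 37 * ℓ ^ 2 * φ * W ^ 4 * 169 * W ^ 2 :=
        le_mul_of_one_le_right (by positivity) hW2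
      have h11 : 37 * ℓ ^ 2 * φ * W ^ 4 * 169 * W ^ 2 = 37 * φ * (169 * ℓ ^ 2 * W ^ 6) := by ring
      have h12 : 37 * φ * (169 * ℓ ^ 2 * W ^ 6) ≤ 37 * φ * φ := mul_le_mul_of_nonneg_left h8 (by positivity)
      nlinarith [h10, h12]
    nlinarith [h7, h9]
  linarith [hA, hB]

end SaddleKernel

end Literature.NumberTheory.Sieve

end
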